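import Summits.CriticalPhenomena.PercolationContinuityZ3.Theorems.PercNearOneGluingNoHeavyLowerTailMajorityGluingQCertCountK
import Summits.CriticalPhenomena.PercolationContinuityZ3.Theorems.PercNearOneGluingNoHeavyLowerTailMajorityGluingQCertEightFive135Fin
import Summits.CriticalPhenomena.PercolationContinuityZ3.Theorems.PercNearOneGluingNoHeavyLowerTailMajorityGluingEightHarris
import HarnessLib

/-!
# Five of eight relays cut from the hub: `μ ≤ (27/20)·max_i μ(vᵢ ↮ a₀)` by a kernel-checked certificate; `C(10), C(11) ≤ 47/20`, `= 2` for `max ≥ 7/27` (lane prim-rate, constants-miner 1, gen 35; CANDIDATES §GEN-35)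

Support file for the closed crux `NoHeavyLowerTail` (stmt-CriticalPhenomena-4575), majority-gluing line.  The ROOT CELL `R_5 = (8,5)` of the window (it closes
`|A| = 10` and, by the cell monotonicity `cutCount_mono`, `|A| = 11`) gets a kernel-checked degree-2 Positivstellensatz certificate `QCert.eightFive135` (kit j278778: cert5.py —
cutting planes on the moment side over ALL hub-rooted van den Berg–Kahn rows and the `2×2` squares of variables/cylinders; case family `1`; exact integer multipliers;
re-verified in the Lean semantics by gen5.py; the kernel evaluation is `…MajorityGluingQCertEightFive135Fin` and its predecessors):
**`fiveOfEight_eightFive135` : `μ(5 ≤ #{v ∈ T : v ↮ a₀}) ≤ (27/20)·δ`** for every finite weighted graph, hub `a₀`, `8`-set `T` and `δ ≥` the cut probabilities (an instance of the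
generic `QCert.cut_of_check_count`).  Consequences via `cutCount_mono` and the generic Harris layer of `…MajorityGluingEightHarris`:
**`majorityGluing_card_ten_eleven_eightFive135` : `C(10), C(11) ≤ 47/20`** (the tree had `13/5` and `5/2` = 1 + (|A|−2)/⌈|A|/2⌉ from additive gluing / Markov),
**`majorityGluing_two_card_ten_eleven_of_ge_eightFive135` : `C(10) = C(11) = 2` whenever `max ≥ 7/27`**, and the Harris form `δ₀ + (27/20)δ₀(1 − δ₀)`.  No sorries.
[cite: VandenbergKahn2001, Thm 1.2 (p. 123)] [cite: KozmaNitzan2024, Conj. 1 (p. 3), Conj. 4 (p. 32)]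
-/

noncomputable section

namespace Summit.CriticalPhenomena.PercolationContinuityZ3.Theorems

open MeasureTheory Set
open Literature.Probability.LatticeModels (prodBernoulli)
open Literature.Probability.Percolation
open scoped Classical

namespace HubOnly

variable {n : ℕ}

/-- **AT LEAST FIVE OF EIGHT RELAYS CUT: `μ ≤ (27/20)·δ`** for every finite weighted graph, hub `a₀`, `8`-set `T` and `δ` bounding the cut probabilities — the
kernel-checked certificate `QCert.eightFive135`. [cite: VandenbergKahn2001, Thm 1.2 (p. 123)] -/
theorem fiveOfEight_eightFive135 (w : Sym2 (Fin n) → unitInterval) (a₀ : Fin n) (T : Finset (Fin n)) (hT : T.card = 8) (δ : ℝ)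
    (hδ : ∀ v ∈ T, (prodBernoulli w).real (openConn v a₀ : Set (BondConfig (Fin n)))ᶜ ≤ δ) :
    (prodBernoulli w).real {ω : BondConfig (Fin n) | 5 ≤ (T.filter fun v => ω ∉ openConn v a₀).card} ≤ 27 / 20 * δ := by
  obtain ⟨v, hv⟩ : T.Nonempty := by rw [← Finset.card_pos, hT]; norm_num
  have hδ0 : 0 ≤ δ := le_trans measureReal_nonneg (hδ v hv)
  have h := QCert.cut_of_check_count QCert.eightFive135 rfl rfl QCert.eightFive135_check w a₀ T hT δ hδ0 hδ
  have hcD : (QCert.eightFive135.cD : ℝ) = 20 := by norm_num [QCert.eightFive135]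
  have hcN : (QCert.eightFive135.cN : ℝ) = 27 := by norm_num [QCert.eightFive135]
  have hh : QCert.eightFive135.h = 5 := rfl
  rw [hcD, hcN, hh] at h
  linarith

/-- The cell(s) of `|A| ∈ {10, 11}` obey the constant bound `(27/20)·δ` (via the cell monotonicity `cutCount_mono`). [cite: VandenbergKahn2001, Thm 1.2 (p. 123)] -/
theorem cell_ten_eleven_eightFive135 (p : Sym2 (Fin n) → unitInterval) (A : Finset (Fin n)) (a₀ : Fin n) (hA1 : 10 ≤ A.card) (hA2 : A.card ≤ 11)
    (T : Finset (Fin n)) (δ : ℝ) (haT : a₀ ∉ T) (_hTA : T ⊆ A) (hTcard : T.card + 2 = A.card) (_hδ : 0 ≤ δ)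
    (hδT : ∀ v ∈ T, (prodBernoulli p).real (openConn v a₀ : Set (BondConfig (Fin n)))ᶜ ≤ δ) :
    (prodBernoulli p).real {ω : BondConfig (Fin n) | (A.card + 1) / 2 ≤ (T.filter fun v => ω ∉ openConn v a₀).card} ≤ 27 / 20 * δ :=
  cutCount_mono p a₀ 8 5 δ (27 / 20 * δ) (fun T₀ hT₀ _ hδT₀ => fiveOfEight_eightFive135 p a₀ T₀ hT₀ δ hδT₀) T ((A.card + 1) / 2)
    (by omega) (by omega) haT hδT

/-- **MAJORITY GLUING AT `|A| ∈ {10, 11}` WITH LOSS `(47/20)·max`:** `μ(o ↔ A) − (47/20)δ₀ ≤ μ(o ↔ a₀ ∧ 2N > |A|)` for every weight function, observer,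
hub `a₀ ∈ A`, `|A| ∈ {10, 11}`, `δ₀ ≥ max_{a∈A} μ(a ↮ a₀)`. [cite: VandenbergKahn2001, Thm 1.2 (p. 123)] [cite: KozmaNitzan2024, Conj. 1 (p. 3)] -/
theorem majorityGluing_card_ten_eleven_eightFive135 (w : Sym2 (Fin n) → unitInterval) (A : Finset (Fin n)) (o a₀ : Fin n) (δ₀ : ℝ)
    (ha₀ : a₀ ∈ A) (hA1 : 10 ≤ A.card) (hA2 : A.card ≤ 11)
    (hδ₀ : ∀ a ∈ A, (prodBernoulli w).real (openConn a a₀ : Set (BondConfig (Fin n)))ᶜ ≤ δ₀) :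
    (prodBernoulli w).real (⋃ a ∈ A, openConn o a) - 47 / 20 * δ₀ ≤
      (prodBernoulli w).real {ω : BondConfig (Fin n) | ω ∈ openConn o a₀ ∧
          A.card < 2 * (A.filter fun a => ω ∈ openConn o a).card} := by
  have h := majorityGluing_of_cellConst w A o a₀ δ₀ ha₀ (by omega) (27 / 20) (by norm_num)
    (fun p _ T δ haT hTA hTcard hδ hδT => cell_ten_eleven_eightFive135 p A a₀ hA1 hA2 T δ haT hTA hTcard hδ hδT) hδ₀
  norm_num at h ⊢
  linarith

/-- **MAJORITY GLUING AT `|A| ∈ {10, 11}`, HARRIS FORM:** loss `δ₀ + (27/20)·δ₀·(1 − δ₀)` for `max_{a∈A} μ(a ↮ a₀) ≤ δ₀ ≤ 20/27`.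
[cite: VandenbergKahn2001, Thm 1.2 (p. 123)] [cite: KozmaNitzan2024, Conj. 1 (p. 3)] -/
theorem majorityGluing_harris_card_ten_eleven_eightFive135 (w : Sym2 (Fin n) → unitInterval) (A : Finset (Fin n)) (o a₀ : Fin n) (δ₀ : ℝ)
    (ha₀ : a₀ ∈ A) (hA1 : 10 ≤ A.card) (hA2 : A.card ≤ 11)
    (hδ₀ : ∀ a ∈ A, (prodBernoulli w).real (openConn a a₀ : Set (BondConfig (Fin n)))ᶜ ≤ δ₀) (hδ₀' : δ₀ ≤ 20 / 27) :
    (prodBernoulli w).real (⋃ a ∈ A, openConn o a) -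
        (prodBernoulli w).real {ω : BondConfig (Fin n) | ω ∈ openConn o a₀ ∧
          A.card < 2 * (A.filter fun a => ω ∈ openConn o a).card}
      ≤ δ₀ + 27 / 20 * δ₀ * (1 - δ₀) :=
  majorityGluing_harris_of_cellConst w A o a₀ δ₀ ha₀ (by omega) (27 / 20) (by norm_num)
    (fun p _ T δ haT hTA hTcard hδ hδT => cell_ten_eleven_eightFive135 p A a₀ hA1 hA2 T δ haT hTA hTcard hδ hδT) hδ₀ (by linarith)

/-- **`C(10) = C(11) = 2` WHENEVER `max ≥ 7/27`:** `μ(o ↔ A) − 2δ₀ ≤ μ(o ↔ a₀ ∧ 2N > |A|)` for `|A| ∈ {10, 11}`, `δ₀ ≥ max_{a∈A} μ(a ↮ a₀)`, `δ₀ ≥ 7/27`.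
[cite: VandenbergKahn2001, Thm 1.2 (p. 123)] [cite: KozmaNitzan2024, Conj. 1 (p. 3), Conj. 4 (p. 32)] -/
theorem majorityGluing_two_card_ten_eleven_of_ge_eightFive135 (w : Sym2 (Fin n) → unitInterval) (A : Finset (Fin n)) (o a₀ : Fin n) (δ₀ : ℝ)
    (ha₀ : a₀ ∈ A) (hA1 : 10 ≤ A.card) (hA2 : A.card ≤ 11)
    (hδ₀ : ∀ a ∈ A, (prodBernoulli w).real (openConn a a₀ : Set (BondConfig (Fin n)))ᶜ ≤ δ₀) (hreg : 7 / 27 ≤ δ₀) :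
    (prodBernoulli w).real (⋃ a ∈ A, openConn o a) - 2 * δ₀ ≤
      (prodBernoulli w).real {ω : BondConfig (Fin n) | ω ∈ openConn o a₀ ∧
          A.card < 2 * (A.filter fun a => ω ∈ openConn o a).card} :=
  majorityGluing_two_of_cellConst w A o a₀ δ₀ ha₀ (by omega) (27 / 20) (by norm_num)
    (fun p _ T δ haT hTA hTcard hδ hδT => cell_ten_eleven_eightFive135 p A a₀ hA1 hA2 T δ haT hTA hTcard hδ hδT) hδ₀ (by linarith)

end HubOnly

end Summit.CriticalPhenomena.PercolationContinuityZ3.Theorems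

end
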